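import Summits.QuantumFields.BalabanUV.Beta.NVertexParitiesW
import Summits.QuantumFields.BalabanUV.Beta.FP.TorusCompositeObjects

/-!
# `BalabanUV.Beta.FP.TowerNParityRowsW` — road «FP» for binder row D1, ROUTE T (β1): **THE END WRAPPER's DISPLAYED (S3-2) N ROW `hWNm` AS A THEOREM IN THE
# WRAPPER's EXACT SHAPE, FROM an2 g61's PART 13 `NVertexParitiesW`** (companion of `FP/TowerNParityRows` p469880: `hVNm hVNt hVN hWN hδN`; the instantiation
# «at the wrapper is the road's», an2 INTENT-4 l.67219 ∕ LANDED-4 l.67233)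

WHY.  The END wrapper `StepRecursionFeedNestedNamedB.d1Tel_JcComp_ctr_named` (p405971 ✓) DISPLAYS
`hWNm : ∀ n μ y ν y′ B a a′, (perF T (dper T (WN (Roots.ctr Lc) Pn (n+1) μ y ν y′))) (fN n B a) (fN n B a′) = 0` (l.282; `T := towerTorus Lc (fine Lc (Mc B)) (n+1)`, the N leg
`fN n B` lands in multiplier fibres by `hmN`, l.261).  an2 g61's PART 13 (`NVertexParitiesW`, p469837 ✓) proves it IN SHAPE for every box, every `R P j`, every such leg
(`perF_dper_WN_apply_of_inr_inr`: the N system's second-order family has no multiplier–multiplier block).  THIS FILE instantiates it at the wrapper's objects, quantifier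
prefix as displayed, so that the next wrapper version writes `hWNm := hWNm_rows Mc Pn fN hmN`.  With `TowerNParityRows` SIX of the seven displayed N parity ∕ letter rows
(`hVN hWN hδN hVNm hVNt hWNm`) are now terms over `fN ∕ hmN`; the seventh, `hWNt` (the ANTI-symmetric `fb` reading), is J-RISK-2′ (an2's J-NOTE l.67219; `g38/SPEC-49.md` §C) and is
NOT typed blind.

WHAT ([folklore] instantiation BY NAME; no `def`, no `def … : Prop`, nothing cited, 0 sorry): `hWNm_rows`.
WHAT THIS IS NOT: not `hWNt`; not a new wrapper version; no estimate; nothing of Bałaban's asserted, valued or discharged; 0∕4 row-D1 binders (hW, hR, D1Tel, D1Rep);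
ROOT M‴ p325680 untouched; NOT (C1), NOT (L2′), NOT (T-ID), NOT SDF, NOT D1, NOT BetaPertH, NOT continuum, NOT Clay.

HONEST DEPENDENCY (page 1, mandatory): continuum YM on T⁴ ⇐ BetaPertH ∧ nine spine estimates (0/9 proved); BetaPertH ⇐ (D1) ∧ (D4) ∧ CAP+tail;
G-an2-4 gates asym, D1 and NE2/3/4.  HONEST FRAMING (cell contract, verbatim): «discharging `BetaPertH` makes Bałaban's UV stability UNCONDITIONAL —
a real constructive-QFT result; it is NOT the continuum limit and NOT the Clay problem.»  ABSOLUTE RULE (cell charter, verbatim): «No internally-minted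
statement may enter as a cited fact. Every hypothesis is either kernel-proved in this package or a verbatim quotation of a PUBLISHED theorem with page
reference. The manuscript(s) under audit are NOT citable for their own disputed steps — they are the thing under adjudication; programme-internal
(2001/route/tribunal) claims are never citable.»  Road «FP» OWNER, b2b-balaban-beta-d1-p3 gen 38, 2026-08-26.  No existing file touched.
-/

noncomputable section

namespace Summit.QuantumFields.BalabanUV.Beta.FP.TowerNParityRowsW

open Literature.MathematicalPhysics.QuantumFieldTheory.Balaban1983to89 Literature.MathematicalPhysics.QuantumFieldTheory.Balaban1983to89.Beta
open B5Prop11Plancherel (fine)  open B6Lemma24Torus (pbox)  open OneStepResolventKernel (Fib)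
open Summit.QuantumFields.BalabanUV.Beta.CompositeOneShotJetData (Roots Pins WN)
open Summit.QuantumFields.BalabanUV.Beta.NVertexParitiesW (perF_dper_WN_apply_of_inr_inr)
open Summit.QuantumFields.BalabanUV.Beta.FP.KernelPeriodisationFib (Idx perF)
open Summit.QuantumFields.BalabanUV.Beta.FP.KernelPeriodisationFibLoc (dper)
open Summit.QuantumFields.BalabanUV.Beta.FP.TorusCompositeObjects (towerTorus)

variable {Lc : ℕ} [NeZero Lc] (Mc : ℕ → (Fin (3 + 1) → ℕ)) (Pn : Pins)
  (fN : ∀ n : ℕ, ∀ B : ℕ, (↥(pbox (Mc B)) × Fin (3 + 1)) → Idx (towerTorus Lc (fine Lc (Mc B)) (n + 1)) (Fib 3))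
  (hmN : ∀ n : ℕ, ∀ B : ℕ, ∀ a : (↥(pbox (Mc B)) × Fin (3 + 1)), ∃ m : Fin (3 + 1), ((fN n) B a).2 = Sum.inr m)
include hmN

/-- [folklore] **`hWNm_rows` — THE WRAPPER's `hWNm` ROW**: on two N-leg indices (multiplier fibres, `hmN`) the periodised second-order N family vanishes, at every depth,
pair of labels and box (an2 PART 13 `perF_dper_WN_apply_of_inr_inr`). -/
theorem hWNm_rows : ∀ (n : ℕ) (μ : Fin (3 + 1)) (y : Fin (3 + 1) → ℤ) (ν : Fin (3 + 1)) (y' : Fin (3 + 1) → ℤ), ∀ B : ℕ, ∀ a a' : (↥(pbox (Mc B)) × Fin (3 + 1)),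
    (perF (towerTorus Lc (fine Lc (Mc B)) (n + 1)) (dper (towerTorus Lc (fine Lc (Mc B)) (n + 1)) ((WN (Roots.ctr Lc) Pn (n + 1)) μ y ν y')))
      (((fN n) B) a) (((fN n) B) a') = 0 :=
  fun n μ y ν y' B a a' =>
    perF_dper_WN_apply_of_inr_inr (Roots.ctr Lc) Pn (n + 1) (towerTorus Lc (fine Lc (Mc B)) (n + 1)) ((fN n) B) ((hmN n) B) μ y ν y' a a'

end Summit.QuantumFields.BalabanUV.Beta.FP.TowerNParityRowsW

end
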